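import Literature.Geometry.Lorentzian.KerrSmearedPlateHardyEdge
import HarnessLib

/-!
# The smeared plate Hardy inequality: pointwise bounds of the bulk of the plate identity

(family `gr`; continuation of `KerrSmearedPlateHardy.lean` / `KerrSmearedPlateHardyEdge.lean`
toward the (HardyPlate) step of Moschidis, arXiv:1509.08489, proof of Lemma 4.5; namespace
`Literature.Geometry.Lorentzian.Kerr`)

The bulk of `Kerr.plateHardy_identity` is `χ'(T − t') (DQ[(0, y)] + Q)/‖y‖²` with `Q = f ψ̃²`.
Here we bound it from below pointwise by the quantity to be controlled minus errors:

* `Kerr.fderiv_cutoffSq_apply`: `DQ(x)[v] = (Df(x)[v]) ψ̃² + 2 f ψ̃ (Dψ̃(x)[v])` at every point;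
* `Kerr.sq_fderiv_apply_spatial_le`: `(Dψ̃(x)[(0, x⃗)])² ≤ ‖x⃗‖² ∑_μ (∂_μψ̃)²` (Cauchy–Schwarz);
* `Kerr.sum_sq_fderiv_le_eight_mul_plateDensity`: at far points (`‖x⃗‖ ≥ R' ≥ 9M`, `R' > R_af`)
  `∑_μ (∂_μψ̃)² ≤ 8 · (−(J^T)⁰[ψ̃])` — the coordinate gradient is controlled by the `∂_{t*}`-energy
  density through the slices (`∑(∂ψ̃)² ≤ 4T(V,V) ≤ 8T(∂_{t*},V)`, `KerrLeafEnergyComparison.lean`);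
* `Kerr.plateHardy_bulk_ge` (**proved**): at every point `x = (t', y)` with `t' ≥ 0`... precisely
  for all `x`,
  `χ'(T − x⁰) (½ f ψ̃² − |Df[(0,x⃗)]| ψ̃² )/‖x⃗‖² − 16 χ'(T − x⁰) f (−(J^T)⁰)
     ≤ χ'(T − x⁰) (DQ[(0,x⃗)] + Q)/‖x⃗‖²`
  (AM–GM `2fψ̃ Dψ̃[(0,y)] ≥ −½fψ̃² − 2f(Dψ̃[(0,y)])²` and the two previous bounds).

Integrated over the wedge with `Kerr.plateHardy_identity` and `Kerr.plateEdge_top_nonpos` this is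
the smeared plate Hardy inequality
`½∫∫χ' f ψ̃²/‖y‖² ≤ (bottom edge) + ∫∫χ'|Df[(0,y)]|ψ̃²/‖y‖² + 16 · (smeared plate ∂_{t*}-energy)`,
whose last term is bounded by `Kerr.farLeafFlux_and_plateEnergy_le`. No definitions, no named
facts (D-0026).

## References

* G. Moschidis, arXiv:1509.08489, proof of Lemma 4.5, (HardyPlate) (key `Moschidis2016`).
* M. Dafermos, I. Rodnianski, Y. Shlapentokh-Rothman, arXiv:1402.7034, §4.3
  (key `DafermosRodnianskiShlapentokhrothman2014`).
-/

noncomputable section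

open Bundle Set TopologicalSpace Filter MeasureTheory Metric
open scoped Manifold ContDiff Topology ENNReal

namespace Literature.Geometry.Lorentzian

namespace Kerr

variable [Facts] [SliceFacts]

/-- **Product rule for `Q = f ψ̃²`** (`f(x) = u_{R',R'}(x⃗)`, `R' > R_af`): at every point of `ℝ⁴`,
`DQ(x)[v] = (Df(x)[v]) ψ̃(x)² + 2 f(x) ψ̃(x) (Dψ̃(x)[v])` (inside the far region by the product rule,
outside `tsupport f` because `f = Df = 0`). [folklore] -/
theorem fderiv_cutoffSq_apply {M a R' : ℝ} (hR'af : afRadius a (rPlus M a) < R')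
    {ψ : region a (rPlus M a) → ℝ} (hψ : IsAdmissibleKerrWave M a ψ) (x v : E4) :
    fderiv ℝ (fun z : E4 ↦ radialTransition R' R' (E4.spatial z) * Function.extend Subtype.val ψ 0 z ^ 2) x v =
      fderiv ℝ (fun z : E4 ↦ radialTransition R' R' (E4.spatial z)) x v * Function.extend Subtype.val ψ 0 x ^ 2 +
        2 * radialTransition R' R' (E4.spatial x) * Function.extend Subtype.val ψ 0 x *
          fderiv ℝ (Function.extend Subtype.val ψ 0) x v := by
  have hR' : 0 < R' := (afRadius_pos a (rPlus M a)).trans hR'af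
  set Φ : E4 → ℝ := Function.extend Subtype.val ψ 0 with hΦ
  set U : Set E4 := {x | afRadius a (rPlus M a) < E4.spatialNorm x} with hU
  have hfU : tsupport (fun z : E4 ↦ radialTransition R' R' (E4.spatial z)) ⊆ U := fun x hx ↦
    hR'af.trans_le (tsupport_radialTransition_comp_spatial_subset hR' hx)
  have hf1 : ContDiff ℝ 1 fun z : E4 ↦ radialTransition R' R' (E4.spatial z) :=
    contDiff_radialTransition_comp_spatial hR'
  have hΦU : ∀ x ∈ U, DifferentiableAt ℝ Φ x := fun x hx ↦
    differentiableAt_extend_of_mem hψ.1 (mem_region_of_afRadius_lt_spatialNorm hx)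
  have hΦ2U : ∀ x ∈ U, DifferentiableAt ℝ (fun z ↦ Φ z ^ 2) x := fun x hx ↦ (hΦU x hx).pow 2
  rw [E4.fderiv_mul_of_tsupport_subset hfU hf1 hΦ2U x v]
  by_cases hx : x ∈ U
  · have h2 : fderiv ℝ (fun z ↦ Φ z ^ 2) x v = 2 * Φ x * fderiv ℝ Φ x v := by
      have := ((hΦU x hx).hasFDerivAt.pow 2).fderiv
      rw [this]
      simp [pow_one]
    rw [h2]; ring
  · have hx' : x ∉ tsupport fun z : E4 ↦ radialTransition R' R' (E4.spatial z) := fun h ↦ hx (hfU h)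
    have hf0 : radialTransition R' R' (E4.spatial x) = 0 :=
      image_eq_zero_of_notMem_tsupport (f := fun z : E4 ↦ radialTransition R' R' (E4.spatial z)) hx'
    have hDf0 : fderiv ℝ (fun z : E4 ↦ radialTransition R' R' (E4.spatial z)) x = 0 :=
      fderiv_of_notMem_tsupport ℝ hx'
    simp [hf0, hDf0]

omit [Facts] [SliceFacts] in
/-- **Cauchy–Schwarz along `(0, x⃗)`**: `(DΦ(x)[(0, x⃗)])² ≤ ‖x⃗‖² ∑_μ (∂_μΦ(x))²`. [folklore] -/
theorem sq_fderiv_apply_spatial_le (Φ : E4 → ℝ) (x : E4) :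
    fderiv ℝ Φ x (E4.ofTimeSpace 0 (E4.spatial x)) ^ 2 ≤
      E4.spatialNorm x ^ 2 * ∑ μ, fderiv ℝ Φ x (E4.basisVector μ) ^ 2 := by
  have hv : E4.ofTimeSpace 0 (E4.spatial x) = ∑ i : Fin 3, x i.succ • E4.basisVector i.succ := by
    ext μ
    refine Fin.cases ?_ (fun j ↦ ?_) μ
    · simp [E4.ofTimeSpace_apply_zero, Fin.sum_univ_three, E4.basisVector]
    · rw [E4.ofTimeSpace_apply_succ, E4.spatial_apply]
      simp [Fin.sum_univ_three, E4.basisVector]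
      fin_cases j <;> simp
  have hD : fderiv ℝ Φ x (E4.ofTimeSpace 0 (E4.spatial x)) =
      ∑ i : Fin 3, x i.succ * fderiv ℝ Φ x (E4.basisVector i.succ) := by
    rw [hv, map_sum]
    exact Finset.sum_congr rfl fun i _ ↦ by rw [map_smul, smul_eq_mul]
  have hCS := Finset.sum_mul_sq_le_sq_mul_sq Finset.univ (fun i : Fin 3 ↦ x i.succ)
    (fun i : Fin 3 ↦ fderiv ℝ Φ x (E4.basisVector i.succ))
  have hsq : ∑ i : Fin 3, x i.succ ^ 2 = E4.spatialNorm x ^ 2 := by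
    rw [E4.spatialNorm_sq, Fin.sum_univ_three]; rfl
  have hsub : ∑ i : Fin 3, fderiv ℝ Φ x (E4.basisVector i.succ) ^ 2 ≤
      ∑ μ, fderiv ℝ Φ x (E4.basisVector μ) ^ 2 := by
    have h4 : ∑ μ, fderiv ℝ Φ x (E4.basisVector μ) ^ 2 =
        fderiv ℝ Φ x (E4.basisVector 0) ^ 2 + ∑ i : Fin 3, fderiv ℝ Φ x (E4.basisVector i.succ) ^ 2 :=
      Fin.sum_univ_succ _
    rw [h4]
    linarith [sq_nonneg (fderiv ℝ Φ x (E4.basisVector 0))]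
  rw [hD]
  calc (∑ i : Fin 3, x i.succ * fderiv ℝ Φ x (E4.basisVector i.succ)) ^ 2
      ≤ (∑ i : Fin 3, x i.succ ^ 2) * ∑ i : Fin 3, fderiv ℝ Φ x (E4.basisVector i.succ) ^ 2 := hCS
    _ ≤ E4.spatialNorm x ^ 2 * ∑ μ, fderiv ℝ Φ x (E4.basisVector μ) ^ 2 := by
        rw [hsq]
        exact mul_le_mul_of_nonneg_left hsub (sq_nonneg _)

/-- **The coordinate gradient is controlled by the `∂_{t*}`-energy density through the slices** at
far points: for `‖x⃗‖ ≥ R'` (`R' > R_af`, `R' ≥ 9M`),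
`∑_μ (∂_μψ̃)² ≤ 8 · (−(J^T)⁰[ψ̃](x))` (`∑(∂ψ̃)² ≤ 4 T(V,V)`,
`Kerr.sum_sq_fderiv_extend_le_four_mul_stressEnergy`; `T(V,V) ≤ 2 T(∂_{t*}, V)` for `H ≤ 1/8`,
`Kerr.far_leaf_comparison` with the zero height). [cite: DafermosRodnianskiShlapentokhrothman2014, §3.1] -/
theorem sum_sq_fderiv_le_eight_mul_plateDensity {M a R' : ℝ} (hMa : IsSubextremal M a)
    (hR'af : afRadius a (rPlus M a) < R') (hR'9 : 9 * M ≤ R') {ψ : region a (rPlus M a) → ℝ}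
    (hψ : IsAdmissibleKerrWave M a ψ) {x : E4} (hx : R' ≤ E4.spatialNorm x) :
    ∑ μ, fderiv ℝ (Function.extend Subtype.val ψ 0) x (E4.basisVector μ) ^ 2 ≤
      8 * -KerrSchild.multiplierCurrent (inverseMetric M a)
        (fun (_ : E4) (ν : Fin 4) ↦ if ν = 0 then (1 : ℝ) else 0) (Function.extend Subtype.val ψ 0) x 0 := by
  have hM : 0 < M := hMa.pos
  obtain ⟨hmem, -, -, h3⟩ := far_leaf_comparison hMa hR'af hR'9 hψ (F := fun _ : E3 ↦ (0 : ℝ))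
    (leafNormal_zero_futureTimelike hMa) hx
  have hsum : ∀ (J : Fin 4 → ℝ), ∑ μ, J μ * graphConormal (fun _ : E3 ↦ (0 : ℝ)) (E4.spatial x) μ = J 0 := by
    intro J
    rw [Fin.sum_univ_succ, graphConormal_zero, mul_one]
    simp [graphConormal_succ, partialE3]
  rw [hsum, hsum] at h3
  have hΦ : DifferentiableAt ℝ (Function.extend Subtype.val ψ 0) x :=
    differentiableAt_extend_of_mem hψ.1 hmem
  have hV := stressEnergy_timeVector_leafNormal_eq M a (extend_rep ψ) (fun _ : E3 ↦ (0 : ℝ)) ⟨x, hmem⟩ hΦ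
  rw [hsum, leafNormal_eq_timeVector ⟨x, hmem⟩ (by simp)] at hV
  have h4 := sum_sq_fderiv_extend_le_four_mul_stressEnergy hM.le ψ ⟨x, hmem⟩
  rw [hV] at h4
  linarith

/-- **Pointwise lower bound of the bulk of the plate identity** (AM–GM and the two previous
bounds): at every point `x` with `x ∈` the far region or not,
`χ'(T − x⁰) (½ f ψ̃² − |Df(x)[(0,x⃗)]| ψ̃²)/‖x⃗‖² − 16 χ'(T − x⁰) f (−(J^T)⁰[ψ̃](x))
   ≤ χ'(T − x⁰) (DQ(x)[(0,x⃗)] + Q(x))/‖x⃗‖²`, `Q = f ψ̃²`.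
[cite: Moschidis2016, Lemma 4.5 (proof, HardyPlate)] -/
theorem plateHardy_bulk_ge {M a R' : ℝ} (hMa : IsSubextremal M a)
    (hR'af : afRadius a (rPlus M a) < R') (hR'9 : 9 * M ≤ R') {ψ : region a (rPlus M a) → ℝ}
    (hψ : IsAdmissibleKerrWave M a ψ) (T : ℝ) (x : E4) :
    deriv Real.smoothTransition (T - x 0) *
          ((1 / 2 * radialTransition R' R' (E4.spatial x) * Function.extend Subtype.val ψ 0 x ^ 2 -
            |fderiv ℝ (fun z : E4 ↦ radialTransition R' R' (E4.spatial z)) x (E4.ofTimeSpace 0 (E4.spatial x))| *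
              Function.extend Subtype.val ψ 0 x ^ 2) / E4.spatialNorm x ^ 2) -
        16 * (deriv Real.smoothTransition (T - x 0) * (radialTransition R' R' (E4.spatial x) *
          -KerrSchild.multiplierCurrent (inverseMetric M a)
            (fun (_ : E4) (ν : Fin 4) ↦ if ν = 0 then (1 : ℝ) else 0) (Function.extend Subtype.val ψ 0) x 0)) ≤
      deriv Real.smoothTransition (T - x 0) *
        ((fderiv ℝ (fun z : E4 ↦ radialTransition R' R' (E4.spatial z) * Function.extend Subtype.val ψ 0 z ^ 2) x
            (E4.ofTimeSpace 0 (E4.spatial x)) +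
          radialTransition R' R' (E4.spatial x) * Function.extend Subtype.val ψ 0 x ^ 2) / E4.spatialNorm x ^ 2) := by
  have hR' : 0 < R' := (afRadius_pos a (rPlus M a)).trans hR'af
  set Φ : E4 → ℝ := Function.extend Subtype.val ψ 0 with hΦ
  have hζ'0 : 0 ≤ deriv Real.smoothTransition (T - x 0) := Real.smoothTransition.monotone.deriv_nonneg
  have hf0 : 0 ≤ radialTransition R' R' (E4.spatial x) := radialTransition_nonneg _ _ _
  rw [fderiv_cutoffSq_apply hR'af hψ]
  by_cases hx : x ∈ tsupport fun z : E4 ↦ radialTransition R' R' (E4.spatial z)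
  · have hxR : R' ≤ E4.spatialNorm x := tsupport_radialTransition_comp_spatial_subset hR' hx
    have hρ : 0 < E4.spatialNorm x := hR'.trans_le hxR
    have hρ2 : 0 < E4.spatialNorm x ^ 2 := by positivity
    have h8 := sum_sq_fderiv_le_eight_mul_plateDensity hMa hR'af hR'9 hψ hxR
    have hCS := sq_fderiv_apply_spatial_le Φ x
    -- abbreviations
    set f := radialTransition R' R' (E4.spatial x) with hf
    set A := fderiv ℝ (fun z : E4 ↦ radialTransition R' R' (E4.spatial z)) x (E4.ofTimeSpace 0 (E4.spatial x))
    set D := fderiv ℝ Φ x (E4.ofTimeSpace 0 (E4.spatial x)) with hD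
    set P := -KerrSchild.multiplierCurrent (inverseMetric M a)
      (fun (_ : E4) (ν : Fin 4) ↦ if ν = 0 then (1 : ℝ) else 0) Φ x 0 with hP
    set S := ∑ μ, fderiv ℝ Φ x (E4.basisVector μ) ^ 2 with hS
    set ζ' := deriv Real.smoothTransition (T - x 0)
    set ρ2 := E4.spatialNorm x ^ 2
    -- `D² ≤ ρ² S ≤ 8 ρ² P`
    have hD2 : D ^ 2 ≤ ρ2 * (8 * P) := hCS.trans (mul_le_mul_of_nonneg_left h8 hρ2.le)
    -- AM–GM `2 f Φ D ≥ −(½ f Φ² + 2 f D²)` and `2 f D² ≤ 16 f P ρ²`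
    have hAM : -(1 / 2 * f * Φ x ^ 2) - 2 * f * D ^ 2 ≤ 2 * f * Φ x * D := by
      nlinarith [mul_nonneg hf0 (sq_nonneg (Φ x + 2 * D))]
    have hAabs : -(|A| * Φ x ^ 2) ≤ A * Φ x ^ 2 := by
      nlinarith [neg_abs_le A, sq_nonneg (Φ x)]
    have hDP : 2 * f * D ^ 2 ≤ 16 * f * P * ρ2 := by
      nlinarith [mul_le_mul_of_nonneg_left hD2 (by positivity : (0 : ℝ) ≤ 2 * f)]
    have key' : 1 / 2 * f * Φ x ^ 2 - |A| * Φ x ^ 2 - 16 * f * P * ρ2 ≤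
        A * Φ x ^ 2 + 2 * f * Φ x * D + f * Φ x ^ 2 := by
      nlinarith [hAM, hAabs, hDP, mul_nonneg hf0 (sq_nonneg (Φ x))]
    have hinv : 0 < ρ2⁻¹ := inv_pos.2 hρ2
    have key : (1 / 2 * f * Φ x ^ 2 - |A| * Φ x ^ 2) / ρ2 - 16 * (f * P) ≤
        (A * Φ x ^ 2 + 2 * f * Φ x * D + f * Φ x ^ 2) / ρ2 := by
      have h1 : (1 / 2 * f * Φ x ^ 2 - |A| * Φ x ^ 2) / ρ2 - 16 * (f * P) =
          (1 / 2 * f * Φ x ^ 2 - |A| * Φ x ^ 2 - 16 * f * P * ρ2) * ρ2⁻¹ := by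
        field_simp
      have h2 : (A * Φ x ^ 2 + 2 * f * Φ x * D + f * Φ x ^ 2) / ρ2 =
          (A * Φ x ^ 2 + 2 * f * Φ x * D + f * Φ x ^ 2) * ρ2⁻¹ := div_eq_mul_inv _ _
      rw [h1, h2]
      exact mul_le_mul_of_nonneg_right key' hinv.le
    have := mul_le_mul_of_nonneg_left key hζ'0
    rw [mul_sub] at this
    linarith [this]
  · have hf00 : radialTransition R' R' (E4.spatial x) = 0 :=
      image_eq_zero_of_notMem_tsupport (f := fun z : E4 ↦ radialTransition R' R' (E4.spatial z)) hx
    have hDf0 : fderiv ℝ (fun z : E4 ↦ radialTransition R' R' (E4.spatial z)) x = 0 :=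
      fderiv_of_notMem_tsupport ℝ hx
    simp [hf00, hDf0]

end Kerr

end Literature.Geometry.Lorentzian
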